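import Summits.ResolutionOfSingularities.ResolutionOfSingularities.Theorems.HomologicalConductorNoZenoRMinimalResolutionGlobal
import Summits.ResolutionOfSingularities.ResolutionOfSingularities.Theorems.HomologicalConductorNoZenoRMinimalOfCriterionMUnconditional
import Summits.ResolutionOfSingularities.ResolutionOfSingularities.Theorems.HomologicalConductorNoZenoRSurfaceResolutionExistence
import HarnessLib

/-!
# Crux `NoZenoR` (stmt-ResolutionOfSingularities-19943) — DOORS for the W3 print `Lipman1969_4_1` (Lipman 1969, Thm. (4.1),
# minimal desingularization of a normal surface with finitely many rational singularities): the print REDUCES, print-free,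
# to ONE LOCAL statement — «the minimal desingularization of `Spec S` (`S` rational) is a blowing up of an `𝔪`-primary ideal»

Route `ResolutionOfSingularities/HomologicalConductor` (cell decomp-res, hand leafhand-res-homologicalconduct-16 g4).
OURS: AI-written, weaker than expert review; SUPPORT level, counted 0; def-free; no NEW named fact (the doors take their
inputs as explicit hypotheses written out in full; the second door consumes the tree's print `Lipman1969_27_1_reg_rat` as a
hypothesis).  Nothing here is a statement of the manuscript under review (Hironaka 2017); no crux / summit statement is proved
and the print `Lipman1969_4_1` is NOT discharged.

* `Lipman1969_4_1_of_localMinimalBlowup` — **door 1 (print-free)**: IF for every two-dimensional normal Noetherian local domain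
  `S` with a rational singularity `Spec S` has a MINIMAL desingularization which is a blowing up along an ideal sheaf cosupported
  at the closed point, THEN `Lipman1969_4_1` — by `GlobalResolution.exists_isMinimalResolution_isBlowup_of_local`
  (`…NoZenoRMinimalResolutionGlobal`: minimality globalises through `Bl_{∏ J_y}(Y)`) and the normal-surface bookkeeping of
  `NormalSurfaceSingularLocus` (singular points are closed with two-dimensional local rings).
* `Lipman1969_4_1_of_27_1_of_isBlowup` — **door 2 (universe 0)**: `Lipman1969_27_1_reg_rat` (through the tree's
  `FirstKind.exists_isMinimalResolution_of_27_1`, hands 16 g3 / 18 g1: a rational `Spec S` HAS a minimal desingularization) AND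
  «every minimal desingularization of a rational `Spec S` is a blowing up along an ideal cosupported at the closed point» ⇒
  `Lipman1969_4_1.{0}`.

The hypothesis isolated by door 2 is the local content of Lipman's clause "any desingularization of `Y` is a product of quadratic
transformations" (Thm. (4.1), via Prop. (8.1): quadratic transforms of rational singularities are normal, and Prop. (3.1): a
desingularization of a non-regular rational `Spec R` dominates the quadratic transform) combined with Stacks 080B (a composition
of point blowing ups is one blowing up, tree `ResolutionIsBlowup.exists_isBlowup_of_isPointBlowupComposition`); equivalently
Cor. (27.2) (projectivity) with Hartshorne II.7.17.  It is NOT proved here.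
-/

noncomputable section

-- single-problem summit: the doubled namespace component `ResolutionOfSingularities` is forced
set_option linter.dupNamespace false

open CategoryTheory AlgebraicGeometry TopologicalSpace IsLocalRing
open Literature.AlgebraicGeometry.Resolution

universe u

namespace Summit.ResolutionOfSingularities.ResolutionOfSingularities.Theorems.NoZeno.GlobalResolution

/-- A singular point of a normal surface has a local ring of Krull dimension exactly `2`. [folklore] -/
theorem ringKrullDim_stalk_eq_two_of_not_mem_regularLocus {Y : Scheme.{u}} [IsIntegral Y] [IsLocallyNoetherian Y]
    (hdim : topologicalKrullDim Y ≤ 2) (hN : ∀ y : Y, IsIntegrallyClosed (Y.presheaf.stalk y)) {y : Y}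
    (hy : y ∉ Scheme.regularLocus Y) : ringKrullDim (Y.presheaf.stalk y) = 2 :=
  le_antisymm ((ringKrullDim_stalk_le_topologicalKrullDim Y y).trans hdim)
    (two_le_ringKrullDim_stalk_of_not_mem_regularLocus hN hy)

/-- **Door 1 (print-free): `Lipman1969_4_1` from the LOCAL statement «a rational `Spec S` has a minimal desingularization which
is a blowing up of an `𝔪`-primary ideal».**  Minimality globalises through the blowing up of the product ideal
(`exists_isMinimalResolution_isBlowup_of_local`). [this work] -/
theorem Lipman1969_4_1_of_localMinimalBlowup
    (hloc : ∀ (S : Type u) [CommRing S] [IsNoetherianRing S] [IsLocalRing S] [IsDomain S] [IsIntegrallyClosed S],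
      ringKrullDim S = 2 → HasRationalSingularity S →
      ∃ (X : Scheme.{u}) (π : X ⟶ Spec (.of S)) (I : (Spec (.of S)).IdealSheafData),
        IsMinimalResolution π ∧ IsBlowup π I ∧ (I.support : Set (Spec (.of S))) ⊆ {closedPoint S}) :
    Lipman1969_4_1.{u} := by
  intro Y _ _ _ hdim hN hfin hrat
  obtain ⟨X, f, -, hf, -, -⟩ := exists_isMinimalResolution_isBlowup_of_local (Scheme.regularLocus Y)ᶜ hfin
    (fun y hy => isClosed_singleton_of_not_mem_regularLocus hN hdim.le hy)
    (fun h => h SurfaceResolutionExistence.genericPoint_mem_regularLocus) (fun y hy => not_not.mp hy) fun y hy => by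
      haveI : IsIntegrallyClosed (Y.presheaf.stalk y) := hN y
      exact hloc (Y.presheaf.stalk y) (ringKrullDim_stalk_eq_two_of_not_mem_regularLocus hdim.le hN hy) (hrat y hy)
  exact ⟨X, f, hf⟩

/-- **Door 2: `Lipman1969_4_1` from `Lipman1969_27_1_reg_rat` and «every minimal desingularization of a rational `Spec S` is a
blowing up of an `𝔪`-primary ideal»** (universe `0`, where the tree's `FirstKind.exists_isMinimalResolution_of_27_1` lives).
[cite: Lipman1969, Theorem (4.1) (p. 204)] -/
theorem Lipman1969_4_1_of_27_1_of_isBlowup (h271 : Lipman1969_27_1_reg_rat.{0})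
    (hbl : ∀ (S : Type) [CommRing S] [IsNoetherianRing S] [IsLocalRing S] [IsDomain S] [IsIntegrallyClosed S],
      ringKrullDim S = 2 → HasRationalSingularity S →
      ∀ (X : Scheme.{0}) (π : X ⟶ Spec (.of S)), IsMinimalResolution π →
        ∃ I : (Spec (.of S)).IdealSheafData, IsBlowup π I ∧ (I.support : Set (Spec (.of S))) ⊆ {closedPoint S}) :
    Lipman1969_4_1.{0} :=
  Lipman1969_4_1_of_localMinimalBlowup fun S _ _ _ _ _ h2 hS => by
    obtain ⟨X, π, hπ⟩ := FirstKind.exists_isMinimalResolution_of_27_1 h271 h2 hS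
    obtain ⟨I, hI, hsupp⟩ := hbl S h2 hS X π hπ
    exact ⟨X, π, I, hπ, hI, hsupp⟩

end Summit.ResolutionOfSingularities.ResolutionOfSingularities.Theorems.NoZeno.GlobalResolution

end
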